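import Mathlib
import Summits.NavierStokesRegularity.FluidComputer.AbcClassIComplexBasesPairing
import Summits.NavierStokesRegularity.FluidComputer.AbcClassIComplexBasesReality
import Summits.NavierStokesRegularity.FluidComputer.AbcClassIIEigenpairOfComplexBases

/-!
# GROUP-B END-TO-END ON THE MODEL, **CLASS I**, IN ARBITRARY COMPLEX (UNITARY) ORBIT BASES (cert-3 g9)
HONEST FRAMING (D-0035/D-0074): not a claim about Navier–Stokes blow-up. WHAT THIS IS NOT: not NS evidence;
MODEL lane (NS linearised about `abcFlow 1 1 1`, CLASS I = the trivial character `ρ_r c = c`, `ρ_s c = c` of the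
24-element symmetry group — the symmetry class of the Hopf rows T2 (`R = 300`) / T4 (`R = 500`) of the CR column);
no certificate, number or census word moves. The class-I twin of cert-3 g8's
`isLinNSEigenvalue_near_of_nested_certificate_of_complex_bases` — SAME statement and proof over the class-I
layer `AbcClassI{Defs,Symmetry,Basis,Index,Synthesis,Sections,ComplexBases*}`: for the COMPLEX first-order matrix
`amc i j = Σ_{k∈O_i} ⟪wf i k, Π_k X(wf j)(k)⟫` of an arbitrary family `wf` of complex orthonormal bases of the
complexified CLASS-I orbit spaces (supported on one orbit, transversal, class I — no conjugate symmetry —,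
`Σ_{k∈O} ⟪wf ⟨O,a⟩ k, wf ⟨O,b⟩ k⟫ = δ_ab`, `odim O` in number), a 3-B-nested certificate row about the section
matrices of `[(λ̃ + |O|²/R)δ − amc]` gives `λ⋆ ∈ ℂ` with `|λ⋆ − λ̃| ≤ 2Mr₀`,
`Torus.IsLinNSEigenvalue (1/(2πR)) (abcFlow 1 1 1) (2πλ⋆)`, ISOLATION in amc-coordinates within
`(1 − 2√2 M² r₀)/M`, REALITY (`Im λ̃ = 0 ∧ 2ρ < r_iso ⇒ Im λ⋆ = 0`; NOT invoked by the Hopf rows, whose `λ̃` is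
complex) and COORDINATES (a non-zero `H^s`-summable amc-coordinate eigenvector). The functional-analytic half
(`BorderedEigenpair*`, `SkewCutGalerkin*`, `AbcLatticeEigenSynthesis`) is character-free and used by name.
Mathlib + the files named; no new definitions. bears_on LADDER-NS N5 / Z4-a(1) (CR rows T2/T4). [folklore].
-/

noncomputable section

open scoped BigOperators ComplexConjugate InnerProductSpace
open Finset MeasureTheory UnitAddTorus Filter Topology

namespace Summit.NavierStokesRegularity.FluidComputer.AbcClassIEigenpair

open Literature.Analysis.FunctionSpaces Literature.Analysis.FunctionSpaces.Torus
open Literature.Analysis.FunctionSpaces.EuclideanSpace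
open Literature.Analysis.FluidPDE Literature.Analysis.FluidPDE.SteadyLattice
open Literature.Analysis.FluidPDE.ScalarFourier
open Summit.NavierStokesRegularity.FluidComputer.AbcClassI
open Summit.NavierStokesRegularity.FluidComputer.AbcClassII (Fam crossForm secOp rotR rotS sgnOrbit cube extend
  restrictTo Orbit toOrbit onormSq osupNorm cubeOrbits nbrOrbits mem_nbrOrbits mem_nbrOrbits_comm toOrbit_eq_iff
  mem_cubeOrbits onormSq_nonneg neg_mem_of_orbitClosed inner_eq_sum_extend extend_apply_of_mem
  extend_apply_of_not_mem sq_osupNorm_le_onormSq kdot_cut sum_cube_filter_eq mem_sgnOrbit_self)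

section OfComplexBases

variable (wf : Idx → Fam)
variable (hws : ∀ i : Idx, ∀ k ∉ i.1.1, wf i k = 0)
variable (hwt : ∀ (i : Idx) (k : Fin 3 → ℤ), ∑ j : Fin 3, ((k j : ℤ) : ℂ) * wf i k j = 0)
variable (hwI : ∀ i : Idx, IsClassI (wf i))
variable (hwon : ∀ (O : Orbit) (a b : Fin (odim O)),
  ∑ k ∈ O.1, (inner ℂ (wf ⟨O, a⟩ k) (wf ⟨O, b⟩ k) : ℂ) = if a = b then 1 else 0)
variable (amc : Idx → Idx → ℂ)
variable (hamc : ∀ i j : Idx, amc i j =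
  ∑ k ∈ i.1.1, (inner ℂ (wf i k) (Torus.lerayCoeff k (crossForm 1 1 1 (wf j) k)) : ℂ))

include hws hwt hwI hwon hamc in

/-- **GROUP-B END-TO-END ON THE MODEL (CLASS I, 3-B-nested row) in ARBITRARY COMPLEX orbit bases** — the class-I twin of
cert-3 g8's `AbcClassIIEigenpair.isLinNSEigenvalue_near_of_nested_certificate_of_complex_bases`. -/
theorem isLinNSEigenvalue_near_of_nested_certificate_of_complex_bases {R : ℝ} (hR : 1 ≤ R) (K Kv : ℕ) (lt : ℂ)
    (vt : AbcClassI.Idx → ℂ) (hvt0 : ∀ i, i ∉ AbcClassI.cubeIdx Kv → vt i = 0)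
    {r₀ nt : ℝ} (hr₀ : 0 ≤ r₀) (hnt : 0 ≤ nt)
    (hres : ∑ i ∈ AbcClassI.cubeIdx Kv ∪ (AbcClassI.cubeIdx Kv).biUnion AbcClassI.nbrIdx,
      ‖(if i ∈ AbcClassI.cubeIdx Kv then (lt - ((-(onormSq i.1 / R) : ℝ) : ℂ)) * vt i else 0) -
        ∑ j ∈ AbcClassI.cubeIdx Kv, amc i j * vt j‖ ^ 2 ≤ r₀ ^ 2)
    (hntb : ∑ i ∈ AbcClassI.cubeIdx Kv \ AbcClassI.cubeIdx K, ‖vt i‖ ^ 2 ≤ nt ^ 2)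
    (Binv : ((↥(AbcClassI.cubeIdx K) → ℂ) × ℂ) →ₗ[ℂ] ((↥(AbcClassI.cubeIdx K) → ℂ) × ℂ))
    (hBinv : ∀ (c : ↥(AbcClassI.cubeIdx K) → ℂ) (m : ℂ),
      Binv (fun i : ↥(AbcClassI.cubeIdx K) => (lt - ((-(onormSq i.1.1 / R) : ℝ) : ℂ)) * c i -
          ∑ j : ↥(AbcClassI.cubeIdx K), amc i j * c j + m * vt i,
        ∑ i : ↥(AbcClassI.cubeIdx K), conj (vt i) * c i) = (c, m))
    {α βB βC gB : ℝ} (hα : 0 ≤ α) (hβB : 0 ≤ βB) (hβC : 0 ≤ βC) (hgB : 0 ≤ gB)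
    (hαM : ∀ (c : ↥(AbcClassI.cubeIdx K) → ℂ) (g : ℂ),
      ∑ j : ↥(AbcClassI.cubeIdx K), ‖(Binv (c, g)).1 j‖ ^ 2 + ‖(Binv (c, g)).2‖ ^ 2 ≤
        α ^ 2 * (∑ i : ↥(AbcClassI.cubeIdx K), ‖c i‖ ^ 2 + ‖g‖ ^ 2))
    (hβBM : ∀ e : AbcClassI.Idx → ℂ,
      ∑ j : ↥(AbcClassI.cubeIdx K), ‖(Binv (fun i : ↥(AbcClassI.cubeIdx K) => -∑ j ∈ AbcClassI.nbrIdx i \ AbcClassI.cubeIdx K,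
          amc i j * e j, 0)).1 j‖ ^ 2 +
        ‖(Binv (fun i : ↥(AbcClassI.cubeIdx K) => -∑ j ∈ AbcClassI.nbrIdx i \ AbcClassI.cubeIdx K,
          amc i j * e j, 0)).2‖ ^ 2 ≤
        βB ^ 2 * ∑ j ∈ (AbcClassI.cubeIdx K).biUnion AbcClassI.nbrIdx \ AbcClassI.cubeIdx K, ‖e j‖ ^ 2)
    (hβCM : ∀ (c : ↥(AbcClassI.cubeIdx K) → ℂ) (g : ℂ),
      ∑ i ∈ ((AbcClassI.cubeIdx K).biUnion AbcClassI.nbrIdx ∪ AbcClassI.cubeIdx Kv) \ AbcClassI.cubeIdx K,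
        ‖-∑ j : ↥(AbcClassI.cubeIdx K), amc i j * (Binv (c, g)).1 j +
          (Binv (c, g)).2 * vt i‖ ^ 2 ≤ βC ^ 2 * (∑ i : ↥(AbcClassI.cubeIdx K), ‖c i‖ ^ 2 + ‖g‖ ^ 2))
    (hgBM : ∀ e : AbcClassI.Idx → ℂ,
      ‖(Binv (fun i : ↥(AbcClassI.cubeIdx K) => ∑ j ∈ AbcClassI.nbrIdx i \ AbcClassI.cubeIdx K,
          amc i j * e j, 0)).2‖ ^ 2 ≤
        gB ^ 2 * ∑ j ∈ (AbcClassI.cubeIdx K).biUnion AbcClassI.nbrIdx \ AbcClassI.cubeIdx K, ‖e j‖ ^ 2)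
    {MU2 μ M : ℝ}
    (hshellM : ∀ e : AbcClassI.Idx → ℂ, (∀ i ∈ AbcClassI.cubeIdx K, e i = 0) →
      MU2 * ∑ i ∈ AbcClassI.cubeIdx (K + 1) \ AbcClassI.cubeIdx K, ‖e i‖ ^ 2 ≤
        ∑ i ∈ AbcClassI.cubeIdx (K + 1) \ AbcClassI.cubeIdx K, (lt.re - (-(onormSq i.1 / R)) - Real.sqrt 2) * ‖e i‖ ^ 2 -
        RCLike.re (∑ i ∈ (AbcClassI.cubeIdx K).biUnion AbcClassI.nbrIdx \ AbcClassI.cubeIdx K,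
          conj (∑ j : ↥(AbcClassI.cubeIdx K), amc i j *
            (Binv (fun i : ↥(AbcClassI.cubeIdx K) => ∑ j ∈ AbcClassI.nbrIdx i \ AbcClassI.cubeIdx K,
              amc i j * e j, 0)).1 j) * e i))
    (htailK : MU2 ≤ lt.re + ((K : ℝ) + 2) ^ 2 / R - Real.sqrt 2)
    (hμdef : μ = MU2 - gB * nt) (hμ : 0 < μ)
    (hMdef : M = √((1 + βC ^ 2) / μ ^ 2 + (α + βB * √(1 + βC ^ 2) / μ) ^ 2))
    (hκ : 2 * Real.sqrt 2 * M ^ 2 * r₀ < 1) :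
    ∃ lam : ℂ, ‖lam - lt‖ ≤ 2 * M * r₀ ∧
      Torus.IsLinNSEigenvalue (1 / (2 * Real.pi * R)) (Torus.abcFlow 1 1 1) (2 * Real.pi * lam) ∧
      (∀ z : ℂ, z ≠ lam → ‖z - lam‖ < (1 - 2 * Real.sqrt 2 * M ^ 2 * r₀) / M →
        ∀ w : AbcClassI.Idx → ℂ, (Summable fun i : AbcClassI.Idx => (1 + onormSq i.1 / R) ^ 2 * ‖w i‖ ^ 2) →
          (∀ i : AbcClassI.Idx, ((-(onormSq i.1 / R) : ℝ) : ℂ) * w i +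
            ∑ j ∈ AbcClassI.nbrIdx i, amc i j * w j = z * w i) → w = 0) ∧
      (lt.im = 0 → 2 * (2 * M * r₀) < (1 - 2 * Real.sqrt 2 * M ^ 2 * r₀) / M → lam.im = 0) ∧
      (∃ w : AbcClassI.Idx → ℂ, w ≠ 0 ∧
        (∀ i : AbcClassI.Idx, ((-(onormSq i.1 / R) : ℝ) : ℂ) * w i +
          ∑ j ∈ AbcClassI.nbrIdx i, amc i j * w j = lam * w i) ∧
        ∀ s : ℕ, Summable fun i : AbcClassI.Idx => (1 + onormSq i.1) ^ s * ‖w i‖ ^ 2) := by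
  classical
  have hR0 : 0 < R := by linarith
  let b : HilbertBasis Idx ℂ (lp (fun _ : Idx => ℂ) 2) := ⟨LinearIsometryEquiv.refl ℂ _⟩
  have hb : ∀ (z : lp (fun _ : Idx => ℂ) 2) (i : Idx), ⟪b i, z⟫_ℂ = z i := fun z i => by
    rw [← b.repr_apply_apply]; rfl
  set ℓ : Idx → ℝ := fun i => -(onormSq i.1 / R) with hℓ
  have hℓ0 : ∀ i, ℓ i ≤ 0 := fun i => neg_nonpos.mpr (div_nonneg (onormSq_nonneg _) hR0.le)
  have hℓt : Tendsto ℓ cofinite atBot := tendsto_levels hR0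
  set Kc : ℝ := 288 * 2592 * Real.sqrt R with hKc
  have hKc0 : 0 ≤ Kc := by positivity
  set P : ℝ := ((288 * 288 : ℕ) : ℝ) * Kc with hP
  have hP0 : 0 ≤ P := by positivity
  set x₀ : ℝ := P ^ 2 + 2 with hx₀
  have hx₀1 : 1 ≤ x₀ := by nlinarith [sq_nonneg P]
  have hx₀0 : 0 < x₀ := by linarith
  obtain ⟨d, hdform, hd, hd0, hw0, hwℓ, -⟩ :=
    SkewCutGalerkinWeights.exists_resolventSymbol (𝕜 := ℂ) ℓ hℓ0 hℓt x₀ hx₀1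
  have hwgt : ∀ i, Real.sqrt (1 + |ℓ i|) = Real.sqrt (1 + onormSq i.1 / R) := fun i => by
    simp only [hℓ]; rw [abs_neg, abs_of_nonneg (div_nonneg (onormSq_nonneg _) hR0.le)]
  set t : Idx → Idx → ℂ := fun i j => amc i j * d j with ht
  have htx : ∀ i j, t i j * ((x₀ : ℂ) - (ℓ j : ℂ)) = amc i j := fun i j => by
    have h := hd j
    change amc i j * d j * ((x₀ : ℂ) - (ℓ j : ℂ)) = amc i j
    linear_combination amc i j * h
  have ht0 : ∀ i j, j ∉ nbrIdx i → t i j = 0 := fun i j hj => by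
    change amc i j * d j = 0
    rw [camc_eq_zero_of_not_mem wf hws hwt hwI amc hamc hj]; simp
  have hgrow : ∀ j : Idx, 288 * (2592 * Real.sqrt (1 + onormSq j.1)) ≤
      Kc * Real.sqrt (1 + onormSq j.1 / R) := by
    intro j
    rw [hKc, mul_assoc, mul_assoc, ← Real.sqrt_mul hR0.le]
    refine mul_le_mul_of_nonneg_left (mul_le_mul_of_nonneg_left (Real.sqrt_le_sqrt ?_) (by norm_num))
      (by norm_num)
    rw [mul_add, mul_one, mul_div_cancel₀ _ hR0.ne']
    linarith [onormSq_nonneg j.1]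
  have ha : ∀ i j, j ∈ nbrIdx i → ‖t i j * ((x₀ : ℂ) - (ℓ j : ℂ))‖ ≤ Kc * Real.sqrt (1 + |ℓ j|) := by
    intro i j _
    rw [htx, hwgt]
    exact (norm_camc_le wf hws hwt hwI hwon amc hamc i j).trans (hgrow j)
  have hL : ∀ i j, j ∈ nbrIdx i →
      Real.sqrt (1 + |ℓ i|) ≤ Real.sqrt (2 * (1 + R⁻¹)) * Real.sqrt (1 + |ℓ j|) := by
    intro i j hj
    rw [hwgt, hwgt, ← Real.sqrt_mul (by positivity)]
    exact Real.sqrt_le_sqrt (one_add_onormSq_le_of_mem_nbrIdx hR0 hj)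
  have hM : ∀ i, ‖d i‖ * Real.sqrt (1 + |ℓ i|) ≤ 1 / Real.sqrt x₀ := by
    intro i
    have e : ‖d i‖ = (x₀ - ℓ i)⁻¹ := by
      rw [hdform i, RCLike.norm_ofReal, abs_of_nonneg (inv_nonneg.mpr (by linarith [hℓ0 i]))]
    rw [e]; exact SkewCutGalerkinLattice.weight_mul_symbol_le (hℓ0 i) hx₀1
  have hxℓ : ∀ i : Idx, ((x₀ : ℂ) - (ℓ i : ℂ)) = ((x₀ - ℓ i : ℝ) : ℂ) := fun i => by push_cast; ring
  have hxℓpos : ∀ i : Idx, 0 < x₀ - ℓ i := fun i => by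
    have := hℓ0 i
    linarith
  have hxℓle : ∀ i : Idx, x₀ - ℓ i ≤ x₀ * (1 + onormSq i.1 / R) := fun i => by
    have hκ0 : 0 ≤ onormSq i.1 / R := div_nonneg (onormSq_nonneg i.1) hR0.le
    have e : ℓ i = -(onormSq i.1 / R) := rfl
    rw [e]; nlinarith
  have hsymm : ∀ i j : Idx, j ∈ nbrIdx i ↔ i ∈ nbrIdx j := mem_nbrIdx_comm
  have hWcard : ∀ i : Idx, (nbrIdx i).card ≤ 288 * 288 := card_nbrIdx_le
  have hq : ((288 * 288 : ℕ) : ℝ) * Kc * (1 / Real.sqrt x₀) < 1 := by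
    rw [← hP, mul_one_div, div_lt_one (Real.sqrt_pos.mpr hx₀0), Real.lt_sqrt hP0, hx₀]
    linarith
  obtain ⟨hrow, hRle, hcol, hCle, hR00, hprod⟩ :=
    SkewCutGalerkinLattice.schur_data_of_band t ℓ x₀ (fun i => d i) hd nbrIdx hsymm hWcard ht0
      (fun i => Real.sqrt (1 + |ℓ i|)) hKc0 (by positivity) ha hM hq
  have hA : ∀ (F : Finset Idx) (c : Idx → ℂ),
      RCLike.re (∑ i ∈ F, ∑ j ∈ F, conj (c i) * (t i j * ((x₀ : ℂ) - (ℓ j : ℂ))) * c j) ≤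
        Real.sqrt 2 * ∑ i ∈ F, ‖c i‖ ^ 2 := fun F c => by
    simp only [htx]
    have hds : ∑ i ∈ F, ∑ j ∈ F, conj (c i) * amc i j * c j =
        ∑ i ∈ F, conj (c i) * ∑ j ∈ F, amc i j * c j :=
      Finset.sum_congr rfl fun i _ => by
        rw [Finset.mul_sum]; exact Finset.sum_congr rfl fun j _ => by ring
    rw [hds]
    exact re_section_pairing_camc wf hws hwt hwI hwon amc hamc F c
  have htail : ∀ i : Idx, i ∉ cubeIdx K → i ∉ cubeIdx (K + 1) \ cubeIdx K →
      MU2 ≤ RCLike.re lt - ℓ i - Real.sqrt 2 := fun i hiK hish => by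
    rw [RCLike.re_to_complex]; exact tail_const_off_shell hR0 K htailK i hiK hish
  have hres' : ∑ i ∈ cubeIdx Kv ∪ (cubeIdx Kv).biUnion nbrIdx,
      ‖(if i ∈ cubeIdx Kv then (lt - (ℓ i : ℂ)) * vt i else 0) -
        ∑ j ∈ cubeIdx Kv, (t i j * ((x₀ : ℂ) - (ℓ j : ℂ))) * vt j‖ ^ 2 ≤ r₀ ^ 2 := by
    simp only [htx]; exact hres
  have hBinv' : ∀ (c : ↥(cubeIdx K) → ℂ) (m : ℂ),
      Binv (fun i : ↥(cubeIdx K) => (lt - (ℓ i : ℂ)) * c i -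
          ∑ j : ↥(cubeIdx K), (t i j * ((x₀ : ℂ) - (ℓ j : ℂ))) * c j + m * vt i,
        ∑ i : ↥(cubeIdx K), conj (vt i) * c i) = (c, m) := by
    intro c m; simp only [htx]; exact hBinv c m
  have hβBM' : ∀ e : Idx → ℂ,
      ∑ j : ↥(cubeIdx K), ‖(Binv (fun i : ↥(cubeIdx K) => -∑ j ∈ nbrIdx i \ cubeIdx K,
          (t i j * ((x₀ : ℂ) - (ℓ j : ℂ))) * e j, 0)).1 j‖ ^ 2 +
        ‖(Binv (fun i : ↥(cubeIdx K) => -∑ j ∈ nbrIdx i \ cubeIdx K,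
          (t i j * ((x₀ : ℂ) - (ℓ j : ℂ))) * e j, 0)).2‖ ^ 2 ≤
        βB ^ 2 * ∑ j ∈ (cubeIdx K).biUnion nbrIdx \ cubeIdx K, ‖e j‖ ^ 2 := by
    intro e; simp only [htx]; exact hβBM e
  have hβCM' : ∀ (c : ↥(cubeIdx K) → ℂ) (g : ℂ),
      ∑ i ∈ ((cubeIdx K).biUnion nbrIdx ∪ cubeIdx Kv) \ cubeIdx K,
        ‖-∑ j : ↥(cubeIdx K), (t i j * ((x₀ : ℂ) - (ℓ j : ℂ))) * (Binv (c, g)).1 j +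
          (Binv (c, g)).2 * vt i‖ ^ 2 ≤ βC ^ 2 * (∑ i : ↥(cubeIdx K), ‖c i‖ ^ 2 + ‖g‖ ^ 2) := by
    intro c g; simp only [htx]; exact hβCM c g
  have hgBM' : ∀ e : Idx → ℂ,
      ‖(Binv (fun i : ↥(cubeIdx K) => ∑ j ∈ nbrIdx i \ cubeIdx K,
          (t i j * ((x₀ : ℂ) - (ℓ j : ℂ))) * e j, 0)).2‖ ^ 2 ≤
        gB ^ 2 * ∑ j ∈ (cubeIdx K).biUnion nbrIdx \ cubeIdx K, ‖e j‖ ^ 2 := by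
    intro e; simp only [htx]; exact hgBM e
  have hshellM' : ∀ e : Idx → ℂ, (∀ i ∈ cubeIdx K, e i = 0) →
      MU2 * ∑ i ∈ cubeIdx (K + 1) \ cubeIdx K, ‖e i‖ ^ 2 ≤
        ∑ i ∈ cubeIdx (K + 1) \ cubeIdx K, (RCLike.re lt - ℓ i - Real.sqrt 2) * ‖e i‖ ^ 2 -
        RCLike.re (∑ i ∈ (cubeIdx K).biUnion nbrIdx \ cubeIdx K,
          conj (∑ j : ↥(cubeIdx K), (t i j * ((x₀ : ℂ) - (ℓ j : ℂ))) *
            (Binv (fun i : ↥(cubeIdx K) => ∑ j ∈ nbrIdx i \ cubeIdx K,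
              (t i j * ((x₀ : ℂ) - (ℓ j : ℂ))) * e j, 0)).1 j) * e i) := by
    intro e he; simp only [htx, RCLike.re_to_complex]; exact hshellM e he
  obtain ⟨T, hTt, -, lam, ws, ⟨hker, hball, hphase⟩, -, -, -, hiso⟩ :=
    BorderedEigenpairPairingSections.certified_eigenpair_of_sections_nested_of_sections b ℓ x₀ d hd
      hd0 t hrow hRle hcol hCle hR00 hR00 hprod nbrIdx hsymm ht0 lt (cubeIdx K) (cubeIdx Kv) vt hvt0
      hr₀ hnt hres' hntb Binv hBinv' hα hβB hβC hgB hαM hβBM' hβCM' hgBM' (cubeIdx (K + 1) \ cubeIdx K)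
      hshellM' htail hμdef hμ hMdef hκ hA
  have hTt0 : ∀ i j, j ∉ nbrIdx i → ⟪b i, T (b j)⟫_ℂ = 0 := fun i j hj => by rw [hTt, ht0 i j hj]
  have hvh : ⟪∑ i ∈ cubeIdx K, vt i • b i, ∑ j ∈ cubeIdx Kv, vt j • b j⟫_ℂ ≠ 0 := by
    intro h0
    obtain ⟨i₀, hi₀, hvi₀⟩ := exists_border_ne_zero (cubeIdx K)
      (fun i => lt - ((-(onormSq i.1 / R) : ℝ) : ℂ)) (fun i j => amc i j) vt Binv hBinv
    have hexp : ⟪∑ i ∈ cubeIdx K, vt i • b i, ∑ j ∈ cubeIdx Kv, vt j • b j⟫_ℂ =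
        ((∑ i ∈ cubeIdx K, ‖vt i‖ ^ 2 : ℝ) : ℂ) := by
      rw [sum_inner, Complex.ofReal_sum]
      refine Finset.sum_congr rfl fun i hi => ?_
      rw [inner_smul_left, SkewCutGalerkinSections.inner_basis_sum_smul]
      have e : (if i ∈ cubeIdx Kv then vt i else 0) = vt i := by
        split_ifs with hiv
        · rfl
        · exact (hvt0 i hiv).symm
      rw [e, mul_comm, Complex.mul_conj, Complex.normSq_eq_norm_sq]
    rw [hexp, Complex.ofReal_eq_zero] at h0
    have h1 := (Finset.sum_eq_zero_iff_of_nonneg fun j _ => sq_nonneg ‖vt j‖).mp h0 i₀ hi₀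
    exact hvi₀ (norm_eq_zero.mp (pow_eq_zero_iff two_ne_zero |>.mp h1))
  set v : lp (fun _ : Idx => ℂ) 2 := b.diagonalCLM d ws with hv
  set wc : Idx → ℂ := fun i => ⟪b i, v⟫_ℂ with hwc
  have hcoord : ∀ i : Idx, ((-(onormSq i.1 / R) : ℝ) : ℂ) * wc i +
      ∑ j ∈ nbrIdx i, amc i j * wc j = lam * wc i := by
    intro i
    have h := BorderedEigenpairFromSectionsCoord.eigen_coord_of_resolventCoord b ℓ x₀ d hd T nbrIdx
      hTt0 lam hker i
    rw [← hv] at h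
    simp only [hTt] at h
    have hs : ∑ j ∈ nbrIdx i, (t i j * ((x₀ : ℂ) - (ℓ j : ℂ))) * wc j =
        ∑ j ∈ nbrIdx i, amc i j * wc j :=
      Finset.sum_congr rfl fun j _ => by rw [htx]
    rw [← hs]
    exact h
  have hreg : ∀ s : ℕ, Summable fun i => Real.sqrt (1 + |ℓ i|) ^ (2 * s) * ‖⟪b i, v⟫_ℂ‖ ^ 2 :=
    fun s => BorderedEigenpairFromSectionsCoord.summable_weights_of_resolventCoord b ℓ x₀ d hd T
      nbrIdx hsymm hWcard hTt0 (fun i => Real.sqrt (1 + |ℓ i|)) hw0 hwℓ hKc0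
      (fun i j hj => by rw [hTt]; exact ha i j hj) (by positivity) hL hM lam hker s
  have hwsum : ∀ s : ℕ, Summable fun i : Idx => (1 + onormSq i.1) ^ s * ‖wc i‖ ^ 2 := by
    intro s
    refine Summable.of_nonneg_of_le (fun i => mul_nonneg (pow_nonneg (by linarith [onormSq_nonneg i.1]) _)
      (sq_nonneg _)) (fun i => ?_) ((hreg s).mul_left (R ^ s))
    have h1 : 1 + onormSq i.1 ≤ R * Real.sqrt (1 + |ℓ i|) ^ 2 := by
      rw [hwgt, Real.sq_sqrt (by linarith [div_nonneg (onormSq_nonneg i.1) hR0.le]), mul_add, mul_one,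
        mul_div_cancel₀ _ hR0.ne']
      linarith [onormSq_nonneg i.1]
    have h2 : (1 + onormSq i.1) ^ s ≤ (R * Real.sqrt (1 + |ℓ i|) ^ 2) ^ s :=
      pow_le_pow_left₀ (by linarith [onormSq_nonneg i.1]) h1 s
    calc (1 + onormSq i.1) ^ s * ‖wc i‖ ^ 2 ≤ (R * Real.sqrt (1 + |ℓ i|) ^ 2) ^ s * ‖wc i‖ ^ 2 :=
          mul_le_mul_of_nonneg_right h2 (sq_nonneg _)
      _ = R ^ s * (Real.sqrt (1 + |ℓ i|) ^ (2 * s) * ‖⟪b i, v⟫_ℂ‖ ^ 2) := by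
          rw [mul_pow, ← pow_mul]; ring
  have hM0 : 0 ≤ M := by rw [hMdef]; exact Real.sqrt_nonneg _
  have hρ0 : 0 ≤ 2 * M * r₀ := mul_nonneg (mul_nonneg zero_le_two hM0) hr₀
  have hv0 : v ≠ 0 := by
    intro h
    apply hvh
    rw [← hphase, h]
    exact inner_zero_right _
  have hclose : ‖lam - lt‖ ≤ 2 * M * r₀ := by
    have h2 : ‖lam - lt‖ ^ 2 ≤ (2 * M * r₀) ^ 2 :=
      le_trans (le_add_of_nonneg_left (sq_nonneg _)) hball
    exact (pow_le_pow_iff_left₀ (norm_nonneg _) hρ0 two_ne_zero).mp h2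
  have hisol : ∀ z : ℂ, z ≠ lam → ‖z - lam‖ < (1 - 2 * Real.sqrt 2 * M ^ 2 * r₀) / M →
      ∀ w : Idx → ℂ, (Summable fun i : Idx => (1 + onormSq i.1 / R) ^ 2 * ‖w i‖ ^ 2) →
        (∀ i : Idx, ((-(onormSq i.1 / R) : ℝ) : ℂ) * w i +
          ∑ j ∈ nbrIdx i, amc i j * w j = z * w i) → w = 0 := by
    intro z hz hzr w hwsum2 hweq
    have h2 : (0 : ℝ) < (2 : ENNReal).toReal := by norm_num
    have hmem : Memℓp (fun i : Idx => ((x₀ : ℂ) - (ℓ i : ℂ)) * w i) 2 := by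
      refine (memℓp_gen_iff h2).2 ?_
      simp_rw [ENNReal.toReal_ofNat, Real.rpow_two]
      have hsum : Summable fun i : Idx => x₀ ^ 2 * ((1 + onormSq i.1 / R) ^ 2 * ‖w i‖ ^ 2) :=
        hwsum2.mul_left _
      refine Summable.of_nonneg_of_le (fun i => sq_nonneg _) (fun i => ?_) hsum
      rw [norm_mul, hxℓ, Complex.norm_real, Real.norm_eq_abs, abs_of_pos (hxℓpos i), mul_pow]
      have h3 : (x₀ - ℓ i) ^ 2 ≤ (x₀ * (1 + onormSq i.1 / R)) ^ 2 :=
        pow_le_pow_left₀ (hxℓpos i).le (hxℓle i) 2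
      calc (x₀ - ℓ i) ^ 2 * ‖w i‖ ^ 2 ≤ (x₀ * (1 + onormSq i.1 / R)) ^ 2 * ‖w i‖ ^ 2 :=
          mul_le_mul_of_nonneg_right h3 (sq_nonneg _)
        _ = x₀ ^ 2 * ((1 + onormSq i.1 / R) ^ 2 * ‖w i‖ ^ 2) := by ring
    set u : lp (fun _ : Idx => ℂ) 2 := ⟨fun i => ((x₀ : ℂ) - (ℓ i : ℂ)) * w i, hmem⟩ with hu
    have hui : ∀ i, ⟪b i, u⟫_ℂ = ((x₀ : ℂ) - (ℓ i : ℂ)) * w i := fun i => (hb u i).trans rfl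
    have hcoordR : ∀ i, ⟪b i, (((1 : lp (fun _ : Idx => ℂ) 2 →L[ℂ] lp (fun _ : Idx => ℂ) 2) - T -
        ((x₀ : ℂ) - z) • b.diagonalCLM d) u)⟫_ℂ = 0 := by
      intro i
      have hc1 : ⟪b i, (((1 : lp (fun _ : Idx => ℂ) 2 →L[ℂ] lp (fun _ : Idx => ℂ) 2) - T -
          ((x₀ : ℂ) - z) • b.diagonalCLM d) u)⟫_ℂ =
          ⟪b i, u⟫_ℂ - ⟪b i, T u⟫_ℂ - ((x₀ : ℂ) - z) * ⟪b i, b.diagonalCLM d u⟫_ℂ := by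
        simp only [sub_apply, smul_apply, one_apply_eq_self, inner_sub_right, inner_smul_right]
      have hc2 := SkewCutGalerkinMaster.inner_basis_map_eq_sum b T nbrIdx hTt0 u i
      have hc3 := SkewCutGalerkinMaster.inner_basis_diagonalCLM b d u i
      have hs : ∑ j ∈ nbrIdx i, ⟪b i, T (b j)⟫_ℂ * ⟪b j, u⟫_ℂ =
          ∑ j ∈ nbrIdx i, amc i j * w j :=
        Finset.sum_congr rfl fun j _ => by rw [hTt, hui, ← mul_assoc, htx]
      have hdi : d i * ((x₀ : ℂ) - (ℓ i : ℂ)) = 1 := hd i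
      have hw : ((ℓ i : ℝ) : ℂ) * w i + ∑ j ∈ nbrIdx i, amc i j * w j = z * w i := hweq i
      rw [hc1, hc2, hs, hc3, hui]
      linear_combination -hw - ((x₀ : ℂ) - z) * w i * hdi
    have hRu : (((1 : lp (fun _ : Idx => ℂ) 2 →L[ℂ] lp (fun _ : Idx => ℂ) 2) - T -
        ((x₀ : ℂ) - z) • b.diagonalCLM d) u) = 0 := by
      apply lp.ext
      funext i
      have e := hb ((((1 : lp (fun _ : Idx => ℂ) 2 →L[ℂ] lp (fun _ : Idx => ℂ) 2) - T -
        ((x₀ : ℂ) - z) • b.diagonalCLM d) u)) i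
      rw [← e, hcoordR i]
      simp
    have hu0 : u = 0 :=
      (ContinuousLinearMap.isUnit_iff_bijective.mp (hiso z hz hzr)).1 (by rw [map_zero]; exact hRu)
    funext i
    have h1 : ((x₀ : ℂ) - (ℓ i : ℂ)) * w i = 0 := by rw [← hui, hu0, inner_zero_right]
    have hne0 : ((x₀ : ℂ) - (ℓ i : ℂ)) ≠ 0 := by rw [hxℓ]; exact_mod_cast (hxℓpos i).ne'
    exact (mul_eq_zero.mp h1).resolve_left hne0
  have hwc0 : wc ≠ 0 := by
    refine fun hall => hv0 (lp.ext (funext fun i => ?_))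
    have := congrFun hall i
    rw [hwc] at this
    simp only [hb] at this
    simpa using this
  -- transfer to instab4's real basis `bfam` through the per-orbit unitary change of basis
  obtain ⟨wa, -, hcoordA, hsumsA, hneA⟩ := ccoord_transfer wf hws hwt hwI hwon amc hamc lam wc hcoord
  have hwsumA : ∀ s : ℕ, Summable fun i : Idx => (1 + onormSq i.1) ^ s * ‖wa i‖ ^ 2 := fun s =>
    summable_of_cube_sums (fun i => (1 + onormSq i.1) ^ s)
      (fun i => pow_nonneg (by linarith [onormSq_nonneg i.1]) _) wc wa
      (fun n => hsumsA n (fun O => (1 + onormSq O) ^ s)) (hwsum s)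
  -- REALITY (`amc` is not a real matrix): conjugation in the real basis + isolation
  have hreal : lt.im = 0 → 2 * (2 * M * r₀) < (1 - 2 * Real.sqrt 2 * M ^ 2 * r₀) / M →
      lam.im = 0 := fun hlt h2ρ =>
    im_eq_zero_of_isolated_coord_eigenvalue wf hws hwt hwI hwon amc hamc hR lam lt wc hwc0 hcoord
      (hwsum 2) hclose hlt h2ρ hisol
  let cf : Fam := fun k => if hk : k = 0 then 0 else
    ∑ a : Fin (odim (toOrbit k hk)), wa ⟨toOrbit k hk, a⟩ • bfam ⟨toOrbit k hk, a⟩ k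
  have hcf0 : cf 0 = 0 := by simp [cf]
  have hcf : ∀ O : Orbit, ∀ k ∈ O.1, cf k = ∑ a : Fin (odim O), wa ⟨O, a⟩ • bfam ⟨O, a⟩ k := by
    intro O k hk
    have hk0 : k ≠ 0 := O.ne_zero_of_mem hk
    have hO : toOrbit k hk0 = O := (toOrbit_eq_iff hk0 O).mpr hk
    subst hO
    simp only [cf, dif_neg hk0]
  have hdecay : RapidDecay cf := rapidDecay_of_coordinates cf wa hcf hcf0 hwsumA
  have hct := kdot_of_coordinates cf wa hcf hcf0
  have hne : cf ≠ 0 := by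
    obtain ⟨i, hi⟩ : ∃ i, wa i ≠ 0 := by
      by_contra hall
      push Not at hall
      exact hneA hwc0 (funext hall)
    exact ne_zero_of_coordinates cf wa hcf hi
  have heq := certifier_eigen_of_coordinates (R := R) lam cf wa hcf hcf0 hcoordA
  exact ⟨lam, hclose,
    AbcLatticeEigenSynthesis.isLinNSEigenvalue_abcFlow_of_certifier_eigen 1 1 1 hR0 lam hdecay hct hcf0
      hne (fun k => heq k), hisol, hreal, wc, hwc0, hcoord, hwsum⟩

end OfComplexBases

end Summit.NavierStokesRegularity.FluidComputer.AbcClassIEigenpair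

end
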